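import Summits.Ventures.YMGap.FlowData.RectTubeTransferOperator
import Summits.Ventures.YMGap.FlowData.TubeFluxSectors
import HarnessLib

/-!
# Venture YMGap, track Y3 FLOW-DATA — rectangular cross-sections: the twists commute with the tube transfer
# operator and the sector projections are `T`-commuting orthogonal projections (v2 twin of `TubeFluxSectors`)

HONEST FRAMING: venture file of the cell `pub-ymgap` (QuantumFields programme), track Y3; companion THEOREMS for
`FlowData/RectTubeTransferOperator.lean` (the `L₁ × L₂` tubes `2×3`, `2×4` of the FLOW-TABLE; lead R237 (c) v2).
Same statements and proofs as `FlowData/TubeFluxSectors.lean` on the rectangular torus `Π_i ℤ/(Ls i)`: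
`rectFluxTwistOp_comp_rectTubeTransferOperator` (central `z`: `C_s ∘ T = T ∘ C_s`),
`rectTubeFluxProjection_comp_rectTubeTransferOperator`, the `ℤ₂^k` representation by self-adjoint isometries
(involution `z`), and — through the abstract character algebra already in the tree — `C_t ∘ P_e = (−1)^{e·t} P_e`,
`P_e² = P_e`, `Σ_e P_e = 1`, `P_e` self-adjoint.  Finite spatial torus; no number, no row, nothing about limits or
a mass gap.

References: G. 't Hooft, Nucl. Phys. B 153 (1979) 141 [cite: tHooft1979Flux]; M. Lüscher, Commun. Math. Phys. 54
(1977) 283 [cite: Luscher1977].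
-/

noncomputable section

open scoped BigOperators ENNReal
open MeasureTheory Filter Function
open Literature.MathematicalPhysics.QuantumFieldTheory Literature.Analysis.OperatorTheory
open Literature.MathematicalPhysics.QuantumLattice (RectTorusSite)

namespace Summit.Ventures.YMGap.FlowData

/-! ### Group law of the twists -/

section TwistAlgebra

variable {G : Type*} [Group G] {k : ℕ} {Ls : Fin k → ℕ}

/-- No direction twisted: the prefactor is `1`. [folklore] -/
@[simp] theorem rectFluxTwistPrefactor_zero (z : G) (e : RectTorusSite Ls × Fin k) :
    rectFluxTwistPrefactor z (0 : Fin k → ZMod 2) e = 1 := by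
  simp [rectFluxTwistPrefactor]

/-- No twist: `rectFluxTwist z 0 = id`. [folklore] -/
@[simp] theorem rectFluxTwist_zero (z : G) : rectFluxTwist (Ls := Ls) z (0 : Fin k → ZMod 2) = id := by
  funext a e
  simp

/-- For an involution `z² = 1` every prefactor squares to `1`. [folklore] -/
theorem rectFluxTwistPrefactor_mul_self (z : G) (hz : z * z = 1) (s : Fin k → ZMod 2)
    (e : RectTorusSite Ls × Fin k) : rectFluxTwistPrefactor z s e * rectFluxTwistPrefactor z s e = 1 := by
  unfold rectFluxTwistPrefactor
  split_ifs
  · exact hz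
  · exact one_mul 1

/-- For an involution, twisting twice by the same `s` is the identity. [folklore] -/
theorem rectFluxTwist_rectFluxTwist_of_mul_self (z : G) (hz : z * z = 1) (s : Fin k → ZMod 2) (a : RectSlice Ls G) :
    rectFluxTwist z s (rectFluxTwist z s a) = a := by
  funext e
  rw [rectFluxTwist_apply, rectFluxTwist_apply, ← mul_assoc, rectFluxTwistPrefactor_mul_self z hz, one_mul]

/-- For an involution `z² = 1` the prefactors multiply like `ℤ₂^k`:
`p_{s'}(e) · p_s(e) = p_{s + s'}(e)`. [folklore] -/
theorem rectFluxTwistPrefactor_mul (z : G) (hz : z * z = 1) (s s' : Fin k → ZMod 2) (e : RectTorusSite Ls × Fin k) :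
    rectFluxTwistPrefactor z s' e * rectFluxTwistPrefactor z s e = rectFluxTwistPrefactor z (s + s') e := by
  unfold rectFluxTwistPrefactor
  simp only [Pi.add_apply]
  rcases ((by decide : ∀ a : ZMod 2, a = 0 ∨ a = 1) (s e.2)) with h | h <;>
    rcases ((by decide : ∀ a : ZMod 2, a = 0 ∨ a = 1) (s' e.2)) with h' | h' <;>
    by_cases hx : e.1 e.2 = 0 <;>
    simp [h, h', hx, hz]

/-- Twisting by `s` and then by `s'` is twisting by `s + s'` (involution `z`). [folklore] -/
theorem rectFluxTwist_rectFluxTwist (z : G) (hz : z * z = 1) (s s' : Fin k → ZMod 2) (a : RectSlice Ls G) :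
    rectFluxTwist z s' (rectFluxTwist z s a) = rectFluxTwist z (s + s') a := by
  funext e
  rw [rectFluxTwist_apply, rectFluxTwist_apply, rectFluxTwist_apply, ← mul_assoc, rectFluxTwistPrefactor_mul z hz]

/-- The twist by `z⁻¹` undoes the twist by `z`. [folklore] -/
theorem rectFluxTwist_inv_rectFluxTwist (z : G) (s : Fin k → ZMod 2) (a : RectSlice Ls G) :
    rectFluxTwist z⁻¹ s (rectFluxTwist z s a) = a := by
  funext e
  rw [rectFluxTwist_apply, rectFluxTwist_apply, ← mul_assoc]
  unfold rectFluxTwistPrefactor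
  split_ifs <;> simp

/-- The twist by `z` undoes the twist by `z⁻¹`. [folklore] -/
theorem rectFluxTwist_rectFluxTwist_inv (z : G) (s : Fin k → ZMod 2) (a : RectSlice Ls G) :
    rectFluxTwist z s (rectFluxTwist z⁻¹ s a) = a := by
  simpa only [inv_inv] using rectFluxTwist_inv_rectFluxTwist z⁻¹ s a

end TwistAlgebra

/-! ### The twist operators represent `ℤ₂^k` -/

section TwistOps

variable {G : Type*} [Group G] [TopologicalSpace G] [IsTopologicalGroup G] [CompactSpace G]
  [MeasurableSpace G] [BorelSpace G] {k : ℕ} {Ls : Fin k → ℕ} [∀ i, NeZero (Ls i)]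

/-- **No twist is the identity operator**: `C_0 = 1`. [folklore] -/
theorem rectFluxTwistOp_zero (z : G) : rectFluxTwistOp Ls z (0 : Fin k → ZMod 2) = 1 := by
  refine ContinuousLinearMap.ext fun ψ => Lp.ext ?_
  refine (rectFluxTwistOp_ae_eq z 0 ψ).trans ?_
  rw [rectFluxTwist_zero]
  exact Eventually.of_forall fun a => rfl

/-- **Group law**: `C_{s'} ∘ C_s = C_{s + s'}` for an involution `z² = 1` — `s ↦ C_s` is a representation of
`ℤ₂^k` by isometries. [cite: tHooft1979Flux] -/
theorem rectFluxTwistOp_comp_rectFluxTwistOp (z : G) (hz : z * z = 1) (s s' : Fin k → ZMod 2) :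
    (rectFluxTwistOp Ls z s').comp (rectFluxTwistOp Ls z s) = rectFluxTwistOp Ls z (s + s') := by
  refine ContinuousLinearMap.ext fun ψ => Lp.ext ?_
  rw [ContinuousLinearMap.comp_apply]
  refine (rectFluxTwistOp_ae_eq z s' (rectFluxTwistOp Ls z s ψ)).trans ?_
  -- `(C_s ψ) ∘ twist_{s'} =ᵐ (ψ ∘ twist_s) ∘ twist_{s'} = ψ ∘ twist_{s+s'}`
  have h1 : ((rectFluxTwistOp Ls z s ψ : RectSlice Ls G → ℝ) ∘ rectFluxTwist z s') =ᵐ[rectSliceMeasure G Ls]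
      (((ψ : RectSlice Ls G → ℝ) ∘ rectFluxTwist z s) ∘ rectFluxTwist z s') :=
    (measurePreserving_rectFluxTwist z s').quasiMeasurePreserving.ae_eq_comp (rectFluxTwistOp_ae_eq z s ψ)
  refine h1.trans ((rectFluxTwistOp_ae_eq z (s + s') ψ).trans ?_).symm
  refine Eventually.of_forall fun a => ?_
  simp only [Function.comp_apply]
  rw [rectFluxTwist_rectFluxTwist z hz s' s, add_comm]

/-- `C_s ∘ C_s = 1` for an involution `z² = 1`. [folklore] -/
theorem rectFluxTwistOp_comp_self (z : G) (hz : z * z = 1) (s : Fin k → ZMod 2) :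
    (rectFluxTwistOp Ls z s).comp (rectFluxTwistOp Ls z s) = 1 := by
  rw [rectFluxTwistOp_comp_rectFluxTwistOp z hz]
  have hs : s + s = 0 := by
    funext μ
    rw [Pi.add_apply, Pi.zero_apply]
    rcases ((by decide : ∀ a : ZMod 2, a = 0 ∨ a = 1) (s μ)) with h | h <;> rw [h] <;> decide
  rw [hs, rectFluxTwistOp_zero]

/-- **`C_s` is self-adjoint** for an involution `z² = 1`: `⟪C_s φ, ψ⟫ = ∫ φ(twist a) ψ(a) da =
∫ φ(b) ψ(twist b) db` (change of variables `a = twist b`, a measure-preserving involution). [folklore] -/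
theorem isSelfAdjoint_rectFluxTwistOp (z : G) (hz : z * z = 1) (s : Fin k → ZMod 2) :
    IsSelfAdjoint (rectFluxTwistOp Ls z s) := by
  set μ : Measure (RectSlice Ls G) := rectSliceMeasure G Ls with hμ
  have hmp : MeasurePreserving (rectFluxTwist z s) μ μ := measurePreserving_rectFluxTwist z s
  rw [ContinuousLinearMap.isSelfAdjoint_iff_isSymmetric]
  intro φ ψ
  change @inner ℝ _ _ (rectFluxTwistOp Ls z s φ) ψ = @inner ℝ _ _ φ (rectFluxTwistOp Ls z s ψ)
  rw [inner_eq_integral, inner_eq_integral]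
  have h1 : ∫ a, (rectFluxTwistOp Ls z s φ : RectSlice Ls G → ℝ) a * ψ a ∂μ =
      ∫ a, φ (rectFluxTwist z s a) * ψ a ∂μ := by
    refine integral_congr_ae ?_
    filter_upwards [rectFluxTwistOp_ae_eq z s φ] with a ha
    rw [ha, Function.comp_apply]
  have h2 : ∫ a, φ a * (rectFluxTwistOp Ls z s ψ : RectSlice Ls G → ℝ) a ∂μ =
      ∫ a, φ a * ψ (rectFluxTwist z s a) ∂μ := by
    refine integral_congr_ae ?_
    filter_upwards [rectFluxTwistOp_ae_eq z s ψ] with a ha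
    rw [ha, Function.comp_apply]
  rw [h1, h2]
  -- change of variables `a = twist b` in the first integral
  have hg : AEStronglyMeasurable (fun a => φ a * ψ (rectFluxTwist z s a)) μ :=
    (Lp.aestronglyMeasurable φ).mul
      ((Lp.aestronglyMeasurable ψ).comp_quasiMeasurePreserving hmp.quasiMeasurePreserving)
  have hg' : AEStronglyMeasurable (fun a => φ a * ψ (rectFluxTwist z s a)) (Measure.map (rectFluxTwist z s) μ) := by
    rw [hmp.map_eq]; exact hg
  have h3 := integral_map hmp.measurable.aemeasurable hg'
  rw [hmp.map_eq] at h3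
  -- `h3 : ∫ (φ a * ψ (twist a)) = ∫ (φ (twist b) * ψ (twist (twist b)))`
  rw [h3]
  refine integral_congr_ae (Eventually.of_forall fun b => ?_)
  dsimp only
  rw [rectFluxTwist_rectFluxTwist_of_mul_self z hz]

end TwistOps

/-! ### The twists and the sector projections commute with the transfer operator -/

section Commute

variable {G : Type*} [Group G] [TopologicalSpace G] [IsTopologicalGroup G] [CompactSpace G]
  [MeasurableSpace G] [BorelSpace G] [SecondCountableTopology G] {n : ℕ} (ρ : G →* Matrix (Fin n) (Fin n) ℂ)
  (J : ℝ) {k : ℕ} {Ls : Fin k → ℕ} [∀ i, NeZero (Ls i)]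

/-- **The twists commute with the transfer operator** for central `z`: `C_s ∘ T = T ∘ C_s`.  Both sides have the
kernel `(a, b) ↦ K(fluxTwist a, b)`: on the left by composing the kernel formula with the measure-preserving twist,
on the right by the twist invariance `K(a, b) = K(twist a, twist b)` and the change of variables `b ↦ twist b`.
[cite: tHooft1979Flux] -/
theorem rectFluxTwistOp_comp_rectTubeTransferOperator (hρ : Continuous ρ) {z : G} (hz : z ∈ Subgroup.center G)
    (s : Fin k → ZMod 2) :
    (rectFluxTwistOp Ls z s).comp (rectTubeTransferOperator ρ J Ls) =
      (rectTubeTransferOperator ρ J Ls).comp (rectFluxTwistOp Ls z s) := by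
  set μ : Measure (RectSlice Ls G) := rectSliceMeasure G Ls with hμ
  set K : RectSlice Ls G → RectSlice Ls G → ℝ := rectSliceKernel ρ J J with hK
  have hmp : MeasurePreserving (rectFluxTwist z s) μ μ := measurePreserving_rectFluxTwist z s
  have hKc : Continuous (uncurry K) := continuous_rectSliceKernel ρ hρ J J
  refine ContinuousLinearMap.ext fun φ => Lp.ext ?_
  rw [ContinuousLinearMap.comp_apply, ContinuousLinearMap.comp_apply]
  -- left-hand side: `C_s (T φ) =ᵐ fun a => ∫ K (twist a) b φ b`
  have hL : (rectFluxTwistOp Ls z s (rectTubeTransferOperator ρ J Ls φ) : RectSlice Ls G → ℝ) =ᵐ[μ]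
      fun a => ∫ b, K (rectFluxTwist z s a) b * φ b ∂μ := by
    refine (rectFluxTwistOp_ae_eq z s _).trans ?_
    exact hmp.quasiMeasurePreserving.ae_eq_comp (rectTubeTransferOperator_ae_eq J Ls hρ φ)
  -- right-hand side: `T (C_s φ) =ᵐ fun a => ∫ K a b φ (twist b) = ∫ K (twist a) c φ c`
  have hR : (rectTubeTransferOperator ρ J Ls (rectFluxTwistOp Ls z s φ) : RectSlice Ls G → ℝ) =ᵐ[μ]
      fun a => ∫ b, K (rectFluxTwist z s a) b * φ b ∂μ := by
    refine (rectTubeTransferOperator_ae_eq J Ls hρ _).trans (Eventually.of_forall fun a => ?_)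
    have hcs := rectFluxTwistOp_ae_eq z s φ
    -- replace `C_s φ` by `φ ∘ twist` under the integral
    have h1 : ∫ b, K a b * (rectFluxTwistOp Ls z s φ : RectSlice Ls G → ℝ) b ∂μ =
        ∫ b, K a b * φ (rectFluxTwist z s b) ∂μ := by
      refine integral_congr_ae ?_
      filter_upwards [hcs] with b hb
      rw [hb, Function.comp_apply]
    -- twist invariance of the kernel and the change of variables
    have h2 : ∫ b, K a b * φ (rectFluxTwist z s b) ∂μ =
        ∫ b, (fun c => K (rectFluxTwist z s a) c * φ c) (rectFluxTwist z s b) ∂μ := by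
      refine integral_congr_ae (Eventually.of_forall fun b => ?_)
      simp only [hK, rectSliceKernel_fluxTwist ρ hz]
    have hg : AEStronglyMeasurable (fun c => K (rectFluxTwist z s a) c * φ c) μ :=
      ((hKc.comp (Continuous.prodMk continuous_const continuous_id)).aestronglyMeasurable).mul
        (Lp.aestronglyMeasurable φ)
    have h3 : ∫ b, (fun c => K (rectFluxTwist z s a) c * φ c) (rectFluxTwist z s b) ∂μ =
        ∫ c, K (rectFluxTwist z s a) c * φ c ∂μ := by
      have hg' : AEStronglyMeasurable (fun c => K (rectFluxTwist z s a) c * φ c)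
          (Measure.map (rectFluxTwist z s) μ) := by rw [hmp.map_eq]; exact hg
      have := integral_map hmp.measurable.aemeasurable hg'
      rw [hmp.map_eq] at this
      exact this.symm
    dsimp only
    rw [h1, h2, h3]
  exact hL.trans hR.symm

/-- **The sector projections commute with the transfer operator** (central `z`): `P_e ∘ T = T ∘ P_e`, so that
`T ∘ P_e` is `T` restricted to the flux sector `e` (and `0` on its complement). [cite: tHooft1979Flux] -/
theorem rectTubeFluxProjection_comp_rectTubeTransferOperator (hρ : Continuous ρ) {z : G} (hz : z ∈ Subgroup.center G)
    (e : Fin k → ZMod 2) :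
    (rectTubeFluxProjection z Ls e).comp (rectTubeTransferOperator ρ J Ls) =
      (rectTubeTransferOperator ρ J Ls).comp (rectTubeFluxProjection z Ls e) := by
  unfold rectTubeFluxProjection fluxProjection
  rw [ContinuousLinearMap.smul_comp, ContinuousLinearMap.comp_smul, ContinuousLinearMap.finsetSum_comp,
    ContinuousLinearMap.comp_finsetSum]
  congr 1
  refine Finset.sum_congr rfl fun s _ => ?_
  rw [ContinuousLinearMap.smul_comp, ContinuousLinearMap.comp_smul,
    rectFluxTwistOp_comp_rectTubeTransferOperator ρ J hρ hz s]

end Commute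

/-! ### The tube's sector projections: eigen-relation, idempotency, completeness, self-adjointness -/

section TubeProjections

variable {G : Type*} [Group G] [TopologicalSpace G] [IsTopologicalGroup G] [CompactSpace G]
  [MeasurableSpace G] [BorelSpace G] {k : ℕ} {Ls : Fin k → ℕ} [∀ i, NeZero (Ls i)] (z : G) (hz : z * z = 1)
include hz

/-- `C_t (P_e ψ) = (−1)^{e·t} P_e ψ`: the range of the tube's `P_e` lies in the flux sector `e`.
[cite: tHooft1979Flux] -/
theorem rectFluxTwistOp_comp_rectTubeFluxProjection (e t : Fin k → ZMod 2) :
    (rectFluxTwistOp Ls z t).comp (rectTubeFluxProjection z Ls e) = fluxSign e t • rectTubeFluxProjection z Ls e :=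
  comp_fluxProjection (rectFluxTwistOp Ls z) (fun s t => rectFluxTwistOp_comp_rectFluxTwistOp z hz s t) e t

/-- The tube's `P_e` is idempotent. [folklore] -/
theorem rectTubeFluxProjection_comp_self (e : Fin k → ZMod 2) :
    (rectTubeFluxProjection z Ls e).comp (rectTubeFluxProjection z Ls e) = rectTubeFluxProjection z Ls e :=
  fluxProjection_comp_self (rectFluxTwistOp Ls z) (fun s t => rectFluxTwistOp_comp_rectFluxTwistOp z hz s t) e

/-- The tube's `P_e` is self-adjoint. [folklore] -/
theorem isSelfAdjoint_rectTubeFluxProjection (e : Fin k → ZMod 2) : IsSelfAdjoint (rectTubeFluxProjection z Ls e) :=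
  isSelfAdjoint_fluxProjection (rectFluxTwistOp Ls z) (fun s => isSelfAdjoint_rectFluxTwistOp z hz s) e

omit hz in
/-- The tube's sector projections sum to the identity: `Σ_e P_e = 1`. [folklore] -/
theorem sum_rectTubeFluxProjection : ∑ e : Fin k → ZMod 2, rectTubeFluxProjection z Ls e = 1 :=
  sum_fluxProjection (rectFluxTwistOp Ls z) (rectFluxTwistOp_zero z)

end TubeProjections

end Summit.Ventures.YMGap.FlowData
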